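import Literature.Topology.FourManifolds.KirbySimplyConnectedSurgery
import HarnessLib

/-!
# `isOrientedBordant_of_isEmpty_of_signature_eq_zero` (Kirby 1989, Cor. IX.2): fact split
# (D-0027 A7 exception, batch libsplit-26)

Split file for the XL named fact
`Literature.Topology.FourManifolds.isOrientedBordant_of_isEmpty_of_signature_eq_zero`
(`BordismFourProofs.lean`; Kirby 1989, Cor. IX.2 with VIII Thm 1(A) and IX Thm 1: *a closed smooth
`ℤ`-oriented `4`-manifold of signature zero is an oriented boundary* — the injectivity of
`σ : Ω₄^SO → ℤ`, equivalently Thom 1954, Thm IV.13).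

The printed proof (R. C. Kirby, *The Topology of 4-Manifolds*, LNM 1374, Ch. VIII, proof of
Thm 1(A)) builds the null-bordism `W = W₁ ∪ W₂ ∪ W₃ ∪ W₄`: `W₁` makes `M` simply connected by
surgery on circles; `W₂ ∪ W₃ ∪ W₄` (Hirsch–Smale immersion `M ↬ ℝ⁶`, removal of triple and double
points through the 1-handle bordisms of VIII Lemmas 5–6, triviality of the normal bundle by IX
Thm 1 (`p₁ = 3σ = 0`), and the Seifert `5`-manifold of VIII Thm 3) then bound the simply connected
manifold. The tree PROVES `W₁` and all the bookkeeping around it (`KirbySimplyConnectedSurgery.lean`: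
`exists_simplyConnectedSpace_isOrientedBordant_signature_eq`, Milnor's trace bordism, Kosinski's
surgery lemma, finite generation of `π₁`; `BordismFourOrientableBoundary.lean`: a smoothly oriented
null-cobordism is a homological oriented bordism to `∅`; `BordismFourUniverse/Components/…`:
universe and connectedness reductions), in the form of the reduction
`isOrientedBordant_of_isEmpty_of_signature_eq_zero_of_simplyConnected_smoothOrientation`.
This file names the one remaining piece as the CHILD fact of the split and proves the assembly:

* `Kirby1989_VIII_thm1A_simplyConnected` — Kirby VIII Thm 1(A) (with IX Thm 1) for SIMPLY CONNECTED
  manifolds, in Kirby's printed form: *a simply connected closed smooth `ℤ`-oriented `4`-manifold of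
  signature zero is the boundary of a compact smooth `5`-manifold carrying a smooth orientation*
  (`NullCobordism 4 M` with `Nonempty (SmoothOrientation (𝓡∂ 5) c.W)`);
* `isOrientedBordant_of_isEmpty_of_signature_eq_zero_holds_of` — the parent (every universe) from
  the child (PROVED: it is `…_of_simplyConnected_smoothOrientation`).

The child is a strict special case of the parent's content (simply connected `M : Type`, smooth
orientation of the bounding manifold instead of a relative fundamental class) and is what steps
`W₂`–`W₄` of the printed proof establish; it is not a restatement of the parent. What its proof
needs and the tree lacks: immersion theory (Hirsch–Smale), Pontryagin classes / `p₁ = 3σ`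
(IX Thm 1), codimension-`2` Seifert manifolds in `ℝ⁷` — or, alternatively, Thom's computation
`Ω₄ ⊗ ℚ ≅ ℚ` via `π_{n+4}(MSO(n))`.

## References

* [Kirby1989] R. C. Kirby, The Topology of 4-Manifolds, LNM 1374 (1989): Ch. VIII Thm 1(A) and
  its proof (`W₁`–`W₄`, Lemmas 5–6, Thms 2–3), Ch. IX Thm 1, Cor. IX.2.
* R. Thom, Comment. Math. Helv. 28 (1954), Thm IV.13 (the alternative route).
* [MilnorHCobordism1965] J. Milnor, Lectures on the h-cobordism theorem (1965), Thm. 3.12.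
-/

noncomputable section

open scoped Manifold ContDiff Topology
open Literature.AlgebraicTopology.SingularHomology

namespace Literature.Topology.FourManifolds

universe u

/-- **Kirby 1989, VIII Thm 1(A) (with IX Thm 1), simply connected case** — CHILD fact of the
split of `isOrientedBordant_of_isEmpty_of_signature_eq_zero`. *Every simply connected closed
smooth `4`-manifold `M` (Hausdorff, second countable, compact, boundaryless smooth structure
modelled on `ℝ⁴`) with a `ℤ`-orientation `μ` of signature zero, `σ(M, μ) = 0`, is the boundary of a
compact smooth `5`-manifold `W` admitting a smooth orientation:* there is a null-cobordism
`c : NullCobordism 4 M` (a compact smooth `5`-manifold with boundary `c.W` with `∂W ≅ M`,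
`Cobordism.lean`) with `Nonempty (SmoothOrientation (𝓡∂ 5) c.W)`. Kirby's proof: immerse `M` in
`ℝ⁶` (Hirsch–Smale; `M` is simply connected, so the only obstruction is handled by `σ = 0` and
IX Thm 1, `p₁(M) = 3σ(M) = 0`), remove triple and double points by the oriented `1`-handle
bordisms `W₂`, `W₃` (VIII Lemmas 5–6), obtaining `M₃ ⊂ ℝ⁶ ⊂ ℝ⁷` embedded with trivial normal
bundle (VIII Thm 2), which bounds a Seifert manifold `W₄ ⊂ ℝ⁷` (VIII Thm 3). Verbatim the
hypothesis `hK` of `isOrientedBordant_of_isEmpty_of_signature_eq_zero_of_simplyConnected_smoothOrientation`.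
[cite: Kirby1989, Ch. VIII Thm 1(A) (proof, W₂–W₄) and Ch. IX Thm 1] -/
def Kirby1989_VIII_thm1A_simplyConnected : Prop :=
  ∀ (M : Type) [TopologicalSpace M] [T2Space M] [SecondCountableTopology M]
    [ChartedSpace (EuclideanSpace ℝ (Fin 4)) M] [CompactSpace M] [IsManifold (𝓡 4) ∞ M]
    [SimplyConnectedSpace M] (μ : HomologicalOrientation ℤ M 4), μ.signature = 0 →
    ∃ c : NullCobordism 4 M, Nonempty (SmoothOrientation (𝓡∂ 5) c.W)

/-- **Assembly of the split (PROVED):** Kirby's Cor. IX.2 — the named fact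
`isOrientedBordant_of_isEmpty_of_signature_eq_zero`, in every universe — follows from its single
child `Kirby1989_VIII_thm1A_simplyConnected`; the surgery step `W₁` (reduction to simply connected
`M`), the passage from a smoothly oriented null-cobordism to a homological oriented bordism with
`∅`, and the universe/connectedness reductions are theorems of the tree
(`isOrientedBordant_of_isEmpty_of_signature_eq_zero_of_simplyConnected_smoothOrientation`).
[cite: Kirby1989, Cor. IX.2 with Ch. VIII Thm 1(A)] -/
theorem isOrientedBordant_of_isEmpty_of_signature_eq_zero_holds_of
    (h : Kirby1989_VIII_thm1A_simplyConnected) :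
    isOrientedBordant_of_isEmpty_of_signature_eq_zero.{u} :=
  isOrientedBordant_of_isEmpty_of_signature_eq_zero_of_simplyConnected_smoothOrientation
    fun M _ _ _ _ _ _ _ μ hμ => h M μ hμ

/-- In particular the child also yields Thom's injectivity statement
`isOrientedBordant_of_signature_eq` (Thm IV.13: equal signatures ⟹ oriented bordant) and hence the
full `isOrientedBordant_iff_signature_eq`, through the tree's proved equivalences
(`isOrientedBordant_of_signature_eq_of_isEmpty`, `BordismFourNullBordism.lean`).
[cite: Kirby1989, Cor. IX.2] -/
theorem isOrientedBordant_of_signature_eq_of_kirby (h : Kirby1989_VIII_thm1A_simplyConnected) :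
    isOrientedBordant_of_signature_eq.{u} :=
  isOrientedBordant_of_signature_eq_of_isEmpty (isOrientedBordant_of_isEmpty_of_signature_eq_zero_holds_of h)

end Literature.Topology.FourManifolds

end
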